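import Summits.MatrixMultiplication.OmegaCensus.STPP211Z2pow5RoomReflect
import Summits.MatrixMultiplication.OmegaCensus.STPP211Z2pow5RoomEngineSel

/-!
# (2,1,1)⁶ in (ℤ/2)⁵ — the X-ROOM CERTIFICATE, part C3: soundness of the chunked first level

Cell `pub-omega` (unit `pub-omega-stpp-1-g35`), topic `Summits/MatrixMultiplication/OmegaCensus`.
HONEST FRAMING (verbatim): lottery ticket; floor = certified bounds/negative ranges. Census STRUCTURE bookkeeping (B5, T1 column at `(ℤ/2)⁵`);
nothing here is a bound on `ω`.

If the selection masks `sels` cover every code and `T1Z2p5.goSel s T ts 0 0 = true` for every `s ∈ sels` (`STPP211Z2pow5RoomEngineSel`), then —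
exactly as for `go (T :: ts)` (`roomX_eq_univ_of_go`, part C2) — every translation-normal-form `(2,1,1)⁶` STPP family of `𝔽₂⁵` with these tables
has X-room set `= univ` (`roomX_eq_univ_of_goSel`): the chunk whose mask contains the code of the true first point carries the true branch through
the first level (`goSel_step0`), the remaining five levels and the leaf are part C2's.

References: H. Cohn, R. Kleinberg, B. Szegedy, C. Umans, FOCS 2005 (arXiv:math/0511460), Def. 5.1.
-/

namespace Summit.MatrixMultiplication.OmegaCensus

namespace T1Z2p5

open Finset STPP211Neg Literature.Computability.AlgebraicComplexity T1Room

variable {a q c : Fin 6 → G5} {C ts : List ℕ}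

/-- `goSel` with the `force`s evaluated. -/
theorem goSel_eq (sel T : ℕ) (rest : List ℕ) (U F : ℕ) : goSel sel T rest U F =
    (!(hasBits (Nat.mul 2 (Nat.succ (List.length rest))) (cpl (Nat.lor U F))) ||
      allBits (Nat.land (Nat.land (cpl (Nat.lor U F)) (cpl (spread T U))) sel) (fun x =>
        allBits (Nat.land (Nat.land (cpl (Nat.lor U F)) (cpl (spread T U))) (Nat.xor full5 (lowMask (Nat.add x 1))))
          (fun x2 => Nat.testBit (fld T 0) (Nat.xor x x2) ||
            go rest (Nat.lor (Nat.lor U (bit x)) (bit x2)) (Nat.lor (Nat.lor F (fld T x)) (fld T x2)))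
          (Nat.land (Nat.land (cpl (Nat.lor U F)) (cpl (spread T U))) (Nat.xor full5 (lowMask (Nat.add x 1)))))
        (Nat.land (Nat.land (cpl (Nat.lor U F)) (cpl (spread T U))) sel)) := by
  unfold goSel
  simp only [force_eq]

/-- THE FIRST STEP THROUGH A CHUNK: if the chunk `sel` contains the code of the first true point and accepts, the engine accepts from the state
of one placed block. -/
theorem goSel_step0 (hS : IsSTPP (fun i => ({a i, q i} : Finset G5)) (fun _ => {0}) (fun i => {c i}))
    (haq : ∀ i, enc (a i) < enc (q i)) (htab : checkTabs C ts = true) (hC : C.length = 6) (hts : ts.length = 6)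
    (hc : ∀ i : Fin 6, C.getD i.val 0 = enc (c i)) {sel : ℕ} (hsel : sel.testBit (enc (a 0)) = true)
    (h : goSel sel (ts.getD 0 0) (ts.drop 1) 0 0 = true) :
    go (ts.drop 1) (usedM a q 1) (F1M ts a q 1) = true := by
  have hm : (0 : ℕ) < 6 := by norm_num
  rw [goSel_eq] at h
  have hlen : (ts.drop 1).length = 5 - 0 := by rw [List.length_drop, hts]
  have hR := hasBits_R (ts := ts) hS haq htab hC hc hm
  rw [show usedM a q 0 = 0 from rfl, show F1M ts a q 0 = 0 from rfl] at hR
  rw [hlen, hR, Bool.not_true, Bool.false_or] at h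
  set T := ts.getD 0 0 with hT
  set S := Nat.land (cpl (Nat.lor 0 0)) (cpl (spread T 0)) with hSdef
  have hSmem : ∀ x : G5, (x = a ⟨0, hm⟩ ∨ x = q ⟨0, hm⟩) → S.testBit (enc x) = true := by
    intro x hx
    have hRx := mem_R (ts := ts) hS htab hC hc (m := 0) (i := ⟨0, hm⟩) le_rfl hx
    rw [show usedM a q 0 = 0 from rfl, show F1M ts a q 0 = 0 from rfl] at hRx
    rw [hSdef, land_eq, Nat.testBit_land, hRx, Bool.true_and, testBit_cpl]
    refine ⟨enc_lt x, ?_⟩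
    by_contra hsp
    rw [Bool.not_eq_false] at hsp
    obtain ⟨z, hz, _⟩ := spread_spec hsp
    simp at hz
  have hS1mem : (Nat.land S sel).testBit (enc (a ⟨0, hm⟩)) = true := by
    rw [land_eq, Nat.testBit_land, hSmem _ (Or.inl rfl), Bool.true_and]; exact hsel
  have h1 := allBits_spec _ _ _ le_rfl h (enc (a ⟨0, hm⟩)) hS1mem
  set S2 := Nat.land S (Nat.xor full5 (lowMask (Nat.add (enc (a ⟨0, hm⟩)) 1))) with hS2
  have hS2mem : S2.testBit (enc (q ⟨0, hm⟩)) = true := by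
    rw [hS2, land_eq, Nat.testBit_land, hSmem _ (Or.inr rfl), Bool.true_and, xor_eq, Nat.testBit_xor, testBit_full5, add_eq', testBit_lowMask]
    have h1' := haq ⟨0, hm⟩
    have h2' := enc_lt (q ⟨0, hm⟩)
    rw [decide_eq_true h2', decide_eq_false (by omega)]
    rfl
  have h2 := allBits_spec _ _ _ le_rfl h1 (enc (q ⟨0, hm⟩)) hS2mem
  rw [Bool.or_eq_true] at h2
  rcases h2 with h2 | h2
  · exfalso
    obtain ⟨j, hj, hzj⟩ := checkTabs_spec htab (i := 0) (by rw [hC]; exact hm) (by norm_num) h2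
    rw [hC] at hj
    rw [hc ⟨0, hm⟩, hc ⟨j, hj⟩] at hzj
    exact pair_ok hS haq hzj
  · have hU' : usedM a q 1 = Nat.lor (Nat.lor 0 (bit (enc (a ⟨0, hm⟩)))) (bit (enc (q ⟨0, hm⟩))) := rfl
    have hF' : F1M ts a q 1 = Nat.lor (Nat.lor 0 (fld T (enc (a ⟨0, hm⟩)))) (fld T (enc (q ⟨0, hm⟩))) := by
      rw [hT]; rfl
    rw [hU', hF']
    exact h2

/-- **SOUNDNESS OF THE CHUNKED ENGINE.** If the selection masks cover all codes and every chunk accepts, every translation-normal-form family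
with these tables has X-room set `= univ`. [cite: CohnKleinbergSzegedyUmans2005, Def. 5.1] -/
theorem roomX_eq_univ_of_goSel (hS : IsSTPP (fun i => ({a i, q i} : Finset G5)) (fun _ => {0}) (fun i => {c i}))
    (haq : ∀ i, enc (a i) < enc (q i)) (htab : checkTabs C ts = true) (hC : C.length = 6) (hts : ts.length = 6)
    (hc : ∀ i : Fin 6, C.getD i.val 0 = enc (c i)) {sels : List ℕ} (hcov : ∀ x : G5, ∃ s ∈ sels, s.testBit (enc x) = true)
    (hall : ∀ s ∈ sels, goSel s (ts.getD 0 0) (ts.drop 1) 0 0 = true) :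
    roomX (fun i => ({a i, q i} : Finset G5)) (fun _ => {0}) (fun i => {c i}) = univ := by
  obtain ⟨s, hs, hsa⟩ := hcov (a 0)
  have h1 := goSel_step0 hS haq htab hC hts hc hsa (hall s hs)
  have h6 := go_step hS haq htab hC hts hc (by norm_num) (go_step hS haq htab hC hts hc (by norm_num)
    (go_step hS haq htab hC hts hc (by norm_num) (go_step hS haq htab hC hts hc (by norm_num)
    (go_step hS haq htab hC hts hc (by norm_num) h1))))
  exact roomX_of_leaf htab hC hts hc h6

end T1Z2p5

end Summit.MatrixMultiplication.OmegaCensus
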